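import Literature.NumberTheory.Weil1964.ArchWeilDatum
import Literature.Analysis.SegalBargmann.FockDualPairCompact
import Literature.Analysis.SegalBargmann.SchwartzTorusIdentification
import HarnessLib

/-!
# Konno–Konno 2007: the Weil representation `ω_{V,W,ξ}` of a real unitary dual pair and the
# `K_V × K_W`-character of its vacuum line

Source: T. Konno, K. Konno, *On doubling construction for real unitary dual pairs*, Kyushu J.
Math. **61** (2007) 35–82, doi:10.2206/kyushujm.61.35 — bib key `KonnoKonno2007`; held as
[corpus: paper:doi-10-2206-kyushujm-61-35] (materialised text `pNNNN.txt`, journal page = PDF page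
+ 34).  [extraction: pdftotext of the held corpus copy; prose and scalar terms legible, verified word
by word by referees r1-g35 / r2-g6 (cell BINDER-TRIAGE §24); displayed operator / weight formulae
column-scrambled and therefore NOT transcribed as quotations — see §3 below.]

This file states ONE named fact, `RealDualPairJunction.FockVacuumCharacter`, over an ABSTRACT
junction datum (nothing about any concrete group is asserted here), plus kernel-checked algebra of
the determinant-power scalar.  It is the print leaf "N-W∞-c" of the cell's model count: it is COUNTED
once, at the place where it is assumed about constructed objects.

## 1. The printed statements (verbatim)

§2.1, p. 37 L31–36 (p0003): "*A non-trivial character `ψ : ℝ → ℂ^×` determines the metaplectic group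
`1 ⟶ ℂ¹ ⟶ Mp(W) ⟶ Sp(W) ⟶ 1` of `(W, ⟨·,·⟩)`. If `Y ⊂ W` is a maximal isotropic (i.e.
Lagrangian) subspace, one has `Mp(W) = Sp(W) × ℂ¹` with the multiplication law
`(g, ε)(g′, ε′) = (gg′, εε′ c_Y(g, g′))`*"; p. 38 L5–11 (p0004): "*`Sp(W)` acts on `H(W)` by
`(w; z).g = (w.g; z)`. According to the Stone–von Neumann theorem, there exists a unique isomorphism
class `ρ_ψ^W = ρ_ψ` of irreducible unitary representation of `H(W)` on which the centre
`{(0; z) | z ∈ ℝ}` acts by `ψ`. Then this uniquely extends to an irreducible unitary representation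
`ρ_ψ` of the metaplectic Jacobi group `J(W) := H(W) ⋊ Mp(W)`. Here, `Mp(W)` acts on `H(W)` by the
`Sp(W)`-action on `W`. The restriction `ω_{W,ψ} = ω_W` of `ρ_ψ` to `Mp(W)` is the Weil representation
of `Mp(W)`.*"; p. 38 L38–39: "*Then `ω_W` is realized on `L²(Y′) = L²(ℝ^N)` and is characterized by
the following formulae: (2.1)*"; p. 39 L23–24 (p0005): "*The restriction of `ρ_ψ` to the subspace
`S(Y′) ⊂ L²(Y′)` of Schwartz–Bruhat functions is a smooth representation of `J(W)`*"; p. 39 L35: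
"*The character `ψ` is of the form `ψ(x) = e^{d_ψ x}` for some `d_ψ ∈ iℝ`.*"

§3.1, p. 43 L38–40 (p0009): "*Thus, the unitary group `G_V := {g ∈ GL_ℂ(V) | (g.v, g.v′) = (v, v′),
∀ v, v′ ∈ V}` of `(V, (·,·))` is isomorphic to `U(p, q)`*" [`(V, (·,·))` hermitian of signature
`(p, q)`, `p + q = n`]; p. 44 L5–13 (p0010): "*We call `(p′, q′)` the signature of `(W, ⟨·,·⟩)`. The
unitary group `G_W := {…}` of `(W, ⟨·,·⟩)` is realized as `U(p′, q′)` … The ℝ-vector space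
`𝕎 := V ⊗_ℂ W` with `⟨⟨v ⊗ w, v′ ⊗ w′⟩⟩ := Re((v, v′)⟨w, w′⟩)` is a symplectic space of dimension
`2(N := nn′)` over ℝ … Then we have a homomorphism `ι_{V,W} = ι_W × ι_V : G_V × G_W ∋ (g, g′) ⟼
g ⊗ g′ ∈ Sp(𝕎)`, and `ι_W(G_V)`, `ι_V(G_W)` form a dual reductive pair in `Sp(𝕎)`.*" and L22–23:
"*To obtain a Weil representation of the unitary dual pair `G_V × G_W`, we need a splitting of
metaplectic extension restricted to `ι_{V,W}(G_V × G_W)`.*"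

§3.3 "Splitting on unitary dual pairs and the Weil representation", p. 47 L51–85 (p0013; the primes
on `n`/`n′`, `ξ`/`ξ′` are lost by the extractor and restored from the introduction, p. 36 L5–6
(p0002) "*For a pair `ξ = (ξ, ξ′)` of characters of `ℂ^×` satisfying `ξ|_{ℝ^×} = sgn^{dim_ℂ W}`,
`ξ′|_{ℝ^×} = sgn^{dim_ℂ V}`, a Weil representation `ω_{V,W,ξ} = ω_{W,ξ} × ω_{V,ξ′}` of `G_V × G_W`
was constructed*"): "*We now fix a pair `ξ = (ξ, ξ′)` of characters
of `ℂ^×` such that `ξ|_{ℝ^×} = sgn^{n′}`, `ξ′|_{ℝ^×} = sgn^{n}`. Using the splittings constructed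
above, we define `ι̃_{W,ξ} : G_V ⟶ G_V × G_V ⟶ G_{V^H} ⟶ Mp(𝕎^H)`, `ι̃_{V,ξ′} : G_W ⟶ G_W × G_W ⟶
G_{W^H} ⟶ Mp(𝕎^H)`, where the left arrows are the embeddings to the first components. Since the
images of these homomorphisms are contained in `ĩ_W(Mp(𝕎) × {1})`, these yield homomorphisms
`ι̃_{W,ξ} : G_V ⟶ Mp(𝕎)`, `ι̃_{V,ξ′} : G_W ⟶ Mp(𝕎)`. For later use, we recall \[HKS96, Lemma 1.1\]
`ι̃_{W⁻,ξ} = ξ(det)⁻¹ ι̃_{W,ξ}`, `ι̃_{V⁻,ξ′} = ξ′(det)⁻¹ ι̃_{V,ξ′}`. (3.5) Composing the above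
homomorphisms with the Weil representation `ω_W` of `Mp(𝕎)`, we obtain the Weil representation
`ω_{V,W,ξ} = ω_{W,ξ} × ω_{V,ξ′}` of `G_V × G_W`: `ω_{W,ξ} := ω_W ∘ ι̃_{W,ξ}`,
`ω_{V,ξ′} := ω_W ∘ ι̃_{V,ξ′}`.*"  (The splittings are "analytic homomorphism[s]", p. 47 L43.)

§4.1, p. 49 L21–28 (p0015): "*The character pair `ξ = (ξ, ξ′)` can be written as
`ξ(z) = (z/z̄)^{m/2}`, `ξ′(z) = (z/z̄)^{m′/2}`, `m ≡ n′`, `m′ ≡ n (mod 2) ∈ ℤ`.*"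

§5.2, p. 72 L7–10 (p0038): "*Let us write `L_n`, `R_m` for the representation of `GL(m, ℂ)`, `GL(n, ℂ)` on
the polynomial ring `ℂ[M_{m,n}(ℂ)]` defined by `L_n(g)R_m(g′)P(w) = P(g⁻¹.w.g′)`, `g ∈ GL(m, ℂ)`,
`g′ ∈ GL(n, ℂ)`, `P(w) ∈ ℂ[M_{m,n}(ℂ)]`.*"  **Lemma 5.2, p. 73 L44–102 (p0039)** — GROUP-level, the
exponents printed IN-LINE (legible; the extractor drops the primes on `p′, q′, m′`, restored here from
the block they decorate — `G_{V^±}`-exponents carry `m` and the signature `(p′, q′)` of `W`,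
`G_{W^±}`-exponents carry `m′` and `(p, q)` — consistently with Prop. 4.4 (i) p. 68 and Thm 5.4 (i)
p. 75): "*LEMMA 5.2. We have the following. (i) If `d_ψ i < 0`, the restriction of
`(ω_{V,W,ξ}, P_{V,W,ξ})` to `K_V × K_W` is given by
`ω_{W,ξ}|_{G_{V⁺}} = det^{(m+q′−p′)/2} L(w_{j,k}) ⊗ R(w_{k,p′+j})`,
`ω_{W,ξ}|_{G_{V⁻}} = det^{(m+p′−q′)/2} R(w_{p+k,j}) ⊗ L(w_{p+j,p′+k})`,
`ω_{V,ξ′}|_{G_{W⁺}} = det^{(m′+p−q)/2} R(w_{j,k}) ⊗ L(w_{p+k,j})`,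
`ω_{V,ξ′}|_{G_{W⁻}} = det^{(m′+q−p)/2} L(w_{k,p′+j}) ⊗ R(w_{p+j,p′+k})`. (ii) Here, for example,
`L(w_{j,k})` denotes the `L_p` on the space `ℂ[(w_{j,k})]`. If `d_ψ i > 0`, `ω_{W,ξ}|_{K_V}`
(respectively `ω_{V,ξ′}|_{K_W}`) on `P_{V,W,ξ}` is given by the formulae in (i) with `W`
(respectively `V`) replaced by `W⁻` (respectively `V⁻`)*" [so for `d_ψ i > 0`: `det^{(m+p′−q′)/2}` on
`G_{V⁺}`, `det^{(m+q′−p′)/2}` on `G_{V⁻}`, `det^{(m′+q−p)/2}` on `G_{W⁺}`, `det^{(m′+p−q)/2}` on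
`G_{W⁻}`, as the extraction of (ii)'s display also shows, p0039 L111–149].  Here
`K_V = G_{V⁺} × G_{V⁻} ≅ U(p) × U(q)`, `K_W = G_{W⁺} × G_{W⁻} ≅ U(p′) × U(q′)` (§4, realisation
w.r.t. the bases `v`, `w`), and `P_{V,W,ξ}` is the Fock model: p. 68 L53–54 (p0034) "*Thus, the Fock
model `P_{V,W,ξ}` for `ω_{V,W,ξ}` is `ℂ[(w_{j,k})]` if `d_ψ i < 0` and `ℂ[(w̄_{j,k})]` otherwise.*"

§5, p. 75 L33–38 (p0041): "*Recall the sign `ε_ψ = d_ψ/(|d_ψ| i) ∈ {±1}`. We set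
`(𝔟_{V,ψ}, 𝔟_{W,ψ}) := (𝔟̄_V, 𝔟_W)` if `ε_ψ = 1`, `(𝔟_V, 𝔟̄_W)` if `ε_ψ = −1`. THEOREM 5.4.
(K-type correspondence)*" — (i), display (5.6): the `𝔟_{V,ψ}`-highest weight of a `K_V`-type
`τ_V` occurring in the Fock space is the sum of a SCALAR weight (entries built from `m/2` and
`ε_ψ(q′ − p′)/2`, `ε_ψ(p′ − q′)/2` on the `U(p)`- and `U(q)`-blocks) and `ε_ψ` times a dominant
"harmonic" part `(−a₁, …, −a_r, 0, …, 0, b_s, …, b₁; −d₁, …, −d_u, 0, …, 0, c_t, …, c₁)`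
(p0041 L62–63, legible), "*for some `a₁ ≥ ⋯ ≥ a_r, b₁ ≥ ⋯ ≥ b_s, c₁ ≥ ⋯ ≥ c_t, d₁ ≥ ⋯ ≥ d_u ∈ ℤ_{>0}`.
Then `τ_V` belongs to `R(K_V, J_{V,W,ξ})` if and only if `r + t ≤ p′`, `s + u ≤ q′`. In that case,
the `𝔟_{W,ψ}`-highest weight of `θ_ξ(τ_V, K_W)` is given by (5.7)*" (L67–69), (5.7) having the
scalar part built from `m′/2` and `ε_ψ(p − q)/2`, `ε_ψ(q − p)/2` and the harmonic part
`ε_ψ(a₁, …, a_r, 0, …, 0, −c_t, …, −c₁; d₁, …, d_u, 0, …, 0, −b_s, …, −b₁)` (L92–93, legible).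

## 2. What the record says, and over what

By Lemma 5.2 the maximal compact `K_V × K_W = (U(p) × U(q)) × (U(p′) × U(q′))` acts on the Fock
model by determinant powers times the substitution representations `L ⊗ R`, which FIX the constant
polynomial; so the vacuum line (the constants of `P_{V,W,ξ}`; under the Bargmann dictionary the
Gaussian) is a `K_V × K_W`-eigenline with eigencharacter
`det(a)^{e_P} det(b)^{e_Q} det(c)^{e_R} det(d)^{e_S}`, `e` = the four printed half-integral-looking but
INTEGER exponents (parities of §4.1) — the `r = s = t = u = 0` member of Thm 5.4 (i) (5.6)/(5.7).
The record `FockVacuumCharacter D e` says exactly: over the junction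
datum `D` (the dual-pair map `ι_{V,W}` into `Sp(𝕎)` in the tree's block coordinates `DPIdx P Q R S`,
with `K_V × K_W = DPK P Q R S` included by `κ` and acting on `𝕎` through the tree's block datum
`dualPairι`), THERE IS an archimedean Weil datum `ω` over `ι_{V,W}` (tree notion
`Literature.NumberTheory.Weil1964.IsArchWeilDatum`: strongly continuous on `𝓢`, Heisenberg-covariant
over `ι_{V,W}`, by restrictions of unitaries of `L²` — for print's `ω_{V,W,ξ} = ω_W ∘ (ι̃_{W,ξ} ×
ι̃_{V,ξ′})` these are the quoted p. 38 L5–11 (covariance: `Mp(𝕎)` acts on `H(𝕎)` through `Sp(𝕎)`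
and `ρ_ψ` extends to `J(𝕎)`), p. 38 L38 (unitary on `L²(ℝ^N)`), p. 39 L23–24 (smooth on `S(Y′)`)
composed with the analytic homomorphisms `ι̃`) whose vacuum vector `hermitePi 0` (the Gaussian) is an
eigenvector of `K_V × K_W` with eigencharacter `vacChar e`, `e = (e_P, e_Q, e_R, e_S)` the four
determinant exponents.

TRANSFER TO THE CELL'S OWN `ω_∞` (instance-level, KERNEL, not part of the record): the record is an
`∃ ω` statement.  Two archimedean Weil data over the same `ι_{V,W}` differ by a continuous unitary
character of `G_V × G_W` (Schur on the Heisenberg side — the tree's rigidity lemmas of the period /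
theta lineage), and such a character restricts to `K_V × K_W` as integer determinant powers
(continuous characters of `U(p,q)` factor through `det`; tree: `CircleChar.exists_eq_zpow` and the
`(T-det)` files); so for the cell's constructed `ω_∞` over `D.ι𝕎` the record yields the vacuum
eigen-equation with exponents `e + (a, a, b, b)` for some `a b : ℤ`, and the instance pins `(a, b)` by
one further readable normalisation of ITS `ω_∞` (e.g. its archimedean splitting characters, cf.
`SplittingCharactersOfArchType`).  None of this is asserted here.

## 3. The exponents are a PARAMETER; the printed values are a named READING

By referee A's ruling K-1 (cell STATUS 2026-08-18T21:07:09Z) the displayed scalars of Prop. 4.4 (i)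
and Thm 5.4 (i) are column-scrambled in the held extraction and may be READ but not QUOTED until a
page image is in the cell; Lemma 5.2's in-line exponents are legible but their primes are an
editorial restoration.  Accordingly the record takes the exponent tuple `e` as a parameter, and the
values this file's author reads off Lemma 5.2 (i)/(ii) (= the scalar parts of (5.6)/(5.7)) —
`e_P = (m + ε_ψ(q′ − p′))/2`, `e_Q = (m + ε_ψ(p′ − q′))/2`, `e_R = (m′ + ε_ψ(p − q))/2`,
`e_S = (m′ + ε_ψ(q − p))/2` (integers by the quoted parities) — are isolated in the separately named
definition `kk07Reading`, whose docstring says so.  An instance cites `FockVacuumCharacter D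
(kk07Reading …)` only after the image check (or with the image-verified tuple written out).

## 4. Object-match obligations of an instance (READ, not quoted — the "D5" dictionary)

(a) `Ginf` = `G_V × G_W` (real points), `D.ι𝕎` = `ι_{V,W}` of (3.1) transported to the tree's
Darboux/block frame of `𝕎 = V ⊗_ℂ W` (index type `DPIdx P Q R S`: `V⁺⊗W⁺, V⁻⊗W⁻` then the mixed
blocks), `D.κ` = the inclusion of `K_V × K_W` = the stabiliser of `V = V⁺ ⊕ V⁻`, `W = W⁺ ⊕ W⁻`,
with `D.ι𝕎_κ` the computation that on `K_V × K_W` the transported `ι_{V,W}` is `realifySp ∘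
dualPairι`.  (b) The tree's additive character at `∞` versus print's `ψ(x) = e^{d_ψ x}`: the instance
must name its `d_ψ` and hence its `ε_ψ = d_ψ/(|d_ψ| i)`; for `ψ_∞(x) = e^{−2πix}` this is
`d_ψ = −2πi`, `ε_ψ = −1`, Fock model `ℂ[(w̄_{j,k})]` (p. 68 L53–55 (p0034): "*the Fock model
`P_{V,W,ξ}` for `ω_{V,W,ξ}` is `ℂ[(w_{j,k})]` if `d_ψ i < 0` and `ℂ[(w̄_{j,k})]` otherwise*").
(c) The tree's `dualPairι` conjugates the two same-sign blocks ("Ichino's sign realised in Folland's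
conventions", `FockDualPairCompact`); print fixes its complex structure on `𝕎_ℂ` in §2.2/§4; the
instance must check that its frame transport carries print's vacuum (the constant polynomial of
`P_{V,W,ξ}`, equivalently the Gaussian of `S(Y′)`) to `hermitePi 0` — a `K_V × K_W`-equivariance
statement — and that the sign pattern of the HARMONIC parts of (5.6)/(5.7) under the transport
reproduces the tree's computed torus weights (`torusChar_dpTorus`), which pins the dictionary.
(d) Print's `ξ` (parity `dim W`) sits on the `G_V`-splitting `ι̃_{W,ξ}`; a consumer whose "μ" is the
∞-type of a Hecke character on the `U(V)` side matches it to `ξ`, not `ξ′`.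
(e) `[HKS96, Lemma 1.1]` (3.5): replacing `W` by `W⁻` twists the `G_V`-splitting by `ξ(det)⁻¹`;
an instance built on `−⟨·,·⟩` must say so.
(f) (referee advisory, record level → instance) The vacuum line's `K_W`-type is the one paired with
the trivial `K_V`-harmonic, `θ_ξ(τ_V, K_W)` in the notation of Thm 5.4 (i), so that the joint
`K_V × K_W`-character on it is (scalar part of (5.6)) ⊠ (scalar part of (5.7)) = Lemma 5.2's
determinant powers; an instance citing the record for a vector other than the vacuum is outside it.

Nothing in §4 is asserted by this file.
-/

set_option autoImplicit false

noncomputable section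

open MeasureTheory Complex SchwartzMap Matrix

namespace Literature.RepresentationTheory.KonnoKonno2007

open Literature.Analysis.SegalBargmann Literature.RepresentationTheory.HeisenbergGroup
open Literature.NumberTheory.Weil1964

variable {P Q R S : Type*} [Fintype P] [DecidableEq P] [Fintype Q] [DecidableEq Q] [Fintype R]
  [DecidableEq R] [Fintype S] [DecidableEq S]
variable {Ginf : Type*} [Group Ginf] [TopologicalSpace Ginf]

/-! ## 1. The junction datum (hypothesis structure; nothing asserted) -/

/-- **Junction of a real unitary dual pair with its maximal compact.**  An abstract topological group
`Ginf` (print: `G_V × G_W`, [KonnoKonno2007, §3.1 p. 44 (3.1)]) with its map `ι𝕎` to the real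
symplectic group of `𝕎 = V ⊗_ℂ W` written in the tree's block coordinates `DPIdx P Q R S`
(`|P| = p, |Q| = q, |R| = p′, |S| = q′`), the inclusion `κ` of the maximal compact
`K_V × K_W = (U(P) × U(Q)) × (U(R) × U(S))`, and the compatibility `ι𝕎 ∘ κ = realifySp ∘ dualPairι`
with the tree's block datum.  A hypothesis structure: its fields are data and equations an instance
supplies; no property of any concrete group is asserted. [folklore] -/
structure RealDualPairJunction (P Q R S : Type*) [Fintype P] [DecidableEq P] [Fintype Q]
    [DecidableEq Q] [Fintype R] [DecidableEq R] [Fintype S] [DecidableEq S]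
    (Ginf : Type*) [Group Ginf] [TopologicalSpace Ginf] where
  /-- `ι_{V,W} : G_V × G_W → Sp(𝕎)` in block coordinates. -/
  ι𝕎 : Ginf →* symplecticGroup (polar (dotPairing (DPIdx P Q R S)))
  /-- the inclusion of the maximal compact `K_V × K_W`. -/
  κ : DPK P Q R S →* Ginf
  /-- `κ` is continuous. -/
  κ_continuous : Continuous κ
  /-- on `K_V × K_W` the symplectic action is the realified block datum `dualPairι`. -/
  ι𝕎_κ : ∀ k, ι𝕎 (κ k) = realifySp (DPIdx P Q R S) (dualPairι k)

/-! ## 2. Determinant-power characters of `K_V × K_W` (kernel) -/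

/-- The four determinant exponents of the character
`((a,b),(c,d)) ↦ det a ^ e_P · det b ^ e_Q · det c ^ e_R · det d ^ e_S` of
`K_V × K_W = (U(P) × U(Q)) × (U(R) × U(S))`. [folklore] -/
structure VacExponents where
  /-- exponent on `U(P) = U(V⁺)`. -/
  eP : ℤ
  /-- exponent on `U(Q) = U(V⁻)`. -/
  eQ : ℤ
  /-- exponent on `U(R) = U(W⁺)`. -/
  eR : ℤ
  /-- exponent on `U(S) = U(W⁻)`. -/
  eS : ℤ

/-- the determinant-power scalar `det a ^ e_P · det b ^ e_Q · det c ^ e_R · det d ^ e_S` of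
`k = ((a,b),(c,d)) ∈ K_V × K_W`, as a complex number. [folklore] -/
def vacScalar (e : VacExponents) (k : DPK P Q R S) : ℂ :=
  (k.1.1 : Matrix P P ℂ).det ^ e.eP * (k.1.2 : Matrix Q Q ℂ).det ^ e.eQ *
    ((k.2.1 : Matrix R R ℂ).det ^ e.eR * (k.2.2 : Matrix S S ℂ).det ^ e.eS)

/-- `vacScalar e 1 = 1`. [folklore] -/
@[simp] theorem vacScalar_one (e : VacExponents) : vacScalar e (1 : DPK P Q R S) = 1 := by
  simp [vacScalar]

/-- `vacScalar e` is multiplicative. [folklore] -/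
theorem vacScalar_mul (e : VacExponents) (k k' : DPK P Q R S) :
    vacScalar e (k * k') = vacScalar e k * vacScalar e k' := by
  simp only [vacScalar, Prod.fst_mul, Prod.snd_mul, Submonoid.coe_mul, Matrix.det_mul, mul_zpow]
  ring

/-- **The determinant-power character** `vacChar e : K_V × K_W →* ℂ`,
`((a,b),(c,d)) ↦ det a ^ e_P · det b ^ e_Q · det c ^ e_R · det d ^ e_S`. [folklore] -/
def vacChar (e : VacExponents) : DPK P Q R S →* ℂ where
  toFun := vacScalar e
  map_one' := vacScalar_one e
  map_mul' := vacScalar_mul e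

/-- unfolding `vacChar`. [folklore] -/
@[simp] theorem vacChar_apply (e : VacExponents) (k : DPK P Q R S) : vacChar e k = vacScalar e k :=
  rfl

/-- the values of `vacChar` are non-zero (determinants of unitary matrices are units). [folklore] -/
theorem vacScalar_ne_zero (e : VacExponents) (k : DPK P Q R S) : vacScalar e k ≠ 0 := by
  have h1 := (Matrix.UnitaryGroup.det_isUnit k.1.1).ne_zero
  have h2 := (Matrix.UnitaryGroup.det_isUnit k.1.2).ne_zero
  have h3 := (Matrix.UnitaryGroup.det_isUnit k.2.1).ne_zero
  have h4 := (Matrix.UnitaryGroup.det_isUnit k.2.2).ne_zero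
  simp only [vacScalar]
  exact mul_ne_zero (mul_ne_zero (zpow_ne_zero _ h1) (zpow_ne_zero _ h2))
    (mul_ne_zero (zpow_ne_zero _ h3) (zpow_ne_zero _ h4))

/-- `‖det u‖ = 1` for a unitary matrix. [folklore] -/
theorem norm_det_unitaryGroup {n : Type*} [Fintype n] [DecidableEq n] (u : Matrix.unitaryGroup n ℂ) :
    ‖(u : Matrix n n ℂ).det‖ = 1 :=
  CStarRing.norm_of_mem_unitary (Matrix.det_of_mem_unitary u.2)

/-- the values of `vacChar` have norm one. [folklore] -/
theorem norm_vacScalar (e : VacExponents) (k : DPK P Q R S) : ‖vacScalar e k‖ = 1 := by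
  simp only [vacScalar, norm_mul, norm_zpow, norm_det_unitaryGroup, _root_.one_zpow, mul_one]

/-- **The determinant-power character with values in the circle group** (same values as `vacChar`).
[folklore] -/
def vacCharCircle (e : VacExponents) : DPK P Q R S →* Circle where
  toFun k := ⟨vacScalar e k, mem_sphere_zero_iff_norm.2 (norm_vacScalar e k)⟩
  map_one' := Circle.ext (by simp)
  map_mul' k k' := Circle.ext (by simp [vacScalar_mul])

/-- unfolding `vacCharCircle`. [folklore] -/
@[simp] theorem coe_vacCharCircle (e : VacExponents) (k : DPK P Q R S) :
    ((vacCharCircle e k : Circle) : ℂ) = vacScalar e k := rfl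

/-- **READING, not a quotation** (see the module docstring §3): the determinant exponents of
[KonnoKonno2007, Lemma 5.2 (i)/(ii), p. 73] (= the scalar parts of Thm 5.4 (5.6)/(5.7), p. 75) for
`G_V = U(p,q)`, `G_W = U(p′,q′)`, `ξ = ((z/z̄)^{m/2}, (z/z̄)^{m′/2})`, `ε = ε_ψ ∈ {±1}` (`ε = 1` is
case (i) `d_ψ i < 0`, `ε = −1` case (ii)), as this file's author reads the extraction with the primes
restored: `e_P = (m + ε(q′ − p′))/2`, `e_Q = (m + ε(p′ − q′))/2`,
`e_R = (m′ + ε(p − q))/2`, `e_S = (m′ + ε(q − p))/2` — integers by the printed parities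
`m ≡ p′ + q′`, `m′ ≡ p + q (mod 2)` (§4.1 p. 49 L21–28); `Int` division is exact under them
(`two_mul_kk07Reading_eP` below).  To be confirmed on the page image before an instance cites it.
[folklore] -/
def kk07Reading (m m' ε : ℤ) (p q p' q' : ℕ) : VacExponents where
  eP := (m + ε * ((q' : ℤ) - p')) / 2
  eQ := (m + ε * ((p' : ℤ) - q')) / 2
  eR := (m' + ε * ((p : ℤ) - q)) / 2
  eS := (m' + ε * ((q : ℤ) - p)) / 2

/-- Under the printed parity `m ≡ p′ + q′ (mod 2)` and `ε = ±1` the division defining `e_P` is exact.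
[folklore] -/
theorem two_mul_kk07Reading_eP (m m' ε : ℤ) (p q p' q' : ℕ) (hε : ε = 1 ∨ ε = -1)
    (hm : Even (m + ((p' : ℤ) + q'))) :
    2 * (kk07Reading m m' ε p q p' q').eP = m + ε * ((q' : ℤ) - p') := by
  obtain ⟨r, hr⟩ := hm
  have h2 : (2 : ℤ) ∣ m + ε * ((q' : ℤ) - p') := by
    rcases hε with h | h
    · subst h; exact ⟨r - p', by linarith⟩
    · subst h; exact ⟨r - q', by linarith⟩
  simp only [kk07Reading]
  exact Int.mul_ediv_cancel' h2

/-- On the vacuum the two `U(V)`-block exponents of the reading differ by `ε (q′ − p′)`: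
`e_P − e_Q = ε (q′ − p′)` (parities as printed) — the number a consumer placing `𝔭₊` uses. [folklore] -/
theorem kk07Reading_eP_sub_eQ (m m' ε : ℤ) (p q p' q' : ℕ) (hε : ε = 1 ∨ ε = -1)
    (hm : Even (m + ((p' : ℤ) + q'))) :
    (kk07Reading m m' ε p q p' q').eP - (kk07Reading m m' ε p q p' q').eQ = ε * ((q' : ℤ) - p') := by
  obtain ⟨r, hr⟩ := hm
  simp only [kk07Reading]
  rcases hε with h | h
  · subst h
    have h1 : (m + 1 * ((q' : ℤ) - p')) = 2 * (r - p') := by linarith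
    have h2 : (m + 1 * ((p' : ℤ) - q')) = 2 * (r - q') := by linarith
    rw [h1, h2, Int.mul_ediv_cancel_left _ two_ne_zero, Int.mul_ediv_cancel_left _ two_ne_zero]
    ring
  · subst h
    have h1 : (m + -1 * ((q' : ℤ) - p')) = 2 * (r - q') := by linarith
    have h2 : (m + -1 * ((p' : ℤ) - q')) = 2 * (r - p') := by linarith
    rw [h1, h2, Int.mul_ediv_cancel_left _ two_ne_zero, Int.mul_ediv_cancel_left _ two_ne_zero]
    ring

/-! ## 3. The record -/

namespace RealDualPairJunction

/-- **[KonnoKonno2007, Lemma 5.2 (i)/(ii) p. 73 (with §5.2 p. 72, §3.3 p. 47, §4.1 p. 49; cf. Thm 5.4 (i) (5.6)/(5.7) p. 75)] —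
the Weil representation of the real unitary dual pair attached to the character pair `ξ` exists over
`ι_{V,W}` and its vacuum line is a `K_V × K_W`-eigenline with a determinant-power eigencharacter.**
Verbatim (p. 47): "*Using the splittings constructed above, we define … these yield homomorphisms
`ι̃_{W,ξ} : G_V → Mp(𝕎)`, `ι̃_{V,ξ′} : G_W → Mp(𝕎)`. … Composing the above homomorphisms with the
Weil representation `ω_W` of `Mp(𝕎)`, we obtain the Weil representation `ω_{V,W,ξ} = ω_{W,ξ} ×
ω_{V,ξ′}` of `G_V × G_W`*"; (p. 49) "*`ξ(z) = (z/z̄)^{m/2}`, `ξ′(z) = (z/z̄)^{m′/2}`, `m ≡ n′`,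
`m′ ≡ n (mod 2)`*"; (p. 73, Lemma 5.2) "*the restriction of `(ω_{V,W,ξ}, P_{V,W,ξ})` to
`K_V × K_W` is given by `ω_{W,ξ}|_{G_{V⁺}} = det^{(m+q′−p′)/2} L(w_{j,k}) ⊗ R(w_{k,p′+j})`, …*"
(four block formulae, module docstring §1; `L`, `R` = substitution `P(w) ↦ P(g⁻¹.w.g′)`, fixing the
constants) — so on the vacuum line `K_V × K_W` acts by the four determinant powers alone (the
`r = s = t = u = 0` member of Thm 5.4 (i) (5.6)/(5.7), p. 75).
Typed over the junction `D`: there is `ω : G_V × G_W → End 𝓢(ℝ^{DPIdx})` which is an archimedean Weil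
datum over `D.ι𝕎` (tree notion `IsArchWeilDatum`) and on whose vacuum `hermitePi 0` the maximal
compact acts by `vacChar e`.  The exponent tuple `e` is a PARAMETER (module docstring §3: the printed
values are the separately named reading `kk07Reading`, to be image-confirmed); the instance's
object-match duties are the module docstring §4 (a)–(f).
[cite: KonnoKonno2007, Lemma 5.2 (i)/(ii) p. 73 L44–102 with §5.2 p. 72 L7–10; §3.3 p. 47 L51–85; §4.1 p. 49 L21–28; cf. Thm 5.4 (i) (5.6)–(5.7) p. 75] -/
def FockVacuumCharacter (D : RealDualPairJunction P Q R S Ginf) (e : VacExponents) : Prop :=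
  ∃ ω : Representation ℂ Ginf (SchwartzMap (DPIdx P Q R S → ℝ) ℂ), IsArchWeilDatum D.ι𝕎 ω ∧
    ∀ k : DPK P Q R S, ω (D.κ k) (hermitePi 0) = vacScalar e k • hermitePi 0

/-! ## 4. Kernel corollaries (0 further facts) -/

variable {D : RealDualPairJunction P Q R S Ginf} {e : VacExponents}

/-- From the record: a Weil datum over `ι_{V,W}` exists at all (the splitting statement, as used by
the tree's `IsArchWeilDatum` consumers). [folklore] -/
theorem FockVacuumCharacter.exists_isArchWeilDatum (h : D.FockVacuumCharacter e) :
    ∃ ω : Representation ℂ Ginf (SchwartzMap (DPIdx P Q R S → ℝ) ℂ), IsArchWeilDatum D.ι𝕎 ω :=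
  let ⟨ω, hω, _⟩ := h
  ⟨ω, hω⟩

/-- From the record: the vacuum is an eigenvector of every `k ∈ K_V × K_W` with eigenvalue
`vacChar e k`. [folklore] -/
theorem FockVacuumCharacter.exists_vacuum_eigen (h : D.FockVacuumCharacter e) :
    ∃ ω : Representation ℂ Ginf (SchwartzMap (DPIdx P Q R S → ℝ) ℂ), IsArchWeilDatum D.ι𝕎 ω ∧
      ∀ k : DPK P Q R S, ω (D.κ k) (hermitePi 0) = vacChar e k • hermitePi 0 :=
  h

end RealDualPairJunction

end Literature.RepresentationTheory.KonnoKonno2007
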